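import Summits.CriticalPhenomena.PercolationContinuityZ3.Theorems.PercNearOneGluingNoHeavyPcintThirdMemKernel
import Summits.CriticalPhenomena.PercolationContinuityZ3.Theorems.PercNearOneGluingNoHeavyPcintThirdMemSym
import Summits.CriticalPhenomena.PercolationContinuityZ3.Theorems.PercNearOneGluingNoHeavyPcintChainMemKernelCert
import HarnessLib

/-!
# PCINT lane, reduced-state B3t certificates (bond): tables, the row check, and the kernel certificate theorem

Cell `prim-pcint` (PAPER-2 track (iii)), seat `prim-pcint-2` (gen 4); support file (`--supports stmt-CriticalPhenomena-4575`).
Does NOT build on p205010.  Same certificate format as `…PcintChordMemKernelCert` (search tree `NawK.NT`: weight `V`, state,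
per-letter successor datum `(row, symmetry number)`); `BondK.checkRowT τ kc d N pn S T D lamN lamD syms t i` recomputes the
SAW step of row `i` at every letter (`BondK.mstepK`, matched by `BondK.termOKB`) and checks the integer Collatz–Wielandt
inequality `lamD · Σ_a pn·CF(c)·S^{u-u_t}·T^{u_t}·D^{6d-u}·(D²+S² ‖ 2D²)·V_j ≤ lamN · 2·S²·T^{2d-1}·D^{6d+3} · V_i` with the
chord numerator `CF(0) = S² T^{2d-1}`, `CF(c) = (D-pn)^c · D · T^{2d-c}` (`c = bchordK ≤ 2d`, `u = cdetK ≤ 4d`,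
`u_t = ctuK ≤ u`).  **`BondK.le_criticalProb_of_checkRowsT`**: if all rows `i < N` pass, row `0` is the empty state, the
symmetry numbers denote lattice symmetries, and `pn ≤ D`, `0 < T ≤ S ≤ D`, `D² ≤ S² + pn²`, `(D-pn)(D+2pn) ≤ T(D+pn)`,
`pn²(D-pn) ≤ S²(S-T)`, `(D-pn)D² ≤ S T²`, `T D ≤ S²`, `lamN < lamD`, `2 ≤ kc`, `kc + 4 ≤ τ`, then `pn/D ≤ p_c^bond(ℤ^d)`
(via `le_criticalProb_zd_of_thirdMemTable` with `s = S/D`, `t = T/D`, `κ̄ = (D²+S²)/(2D²)`).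
Memo: run/shared/lean/prim/pcint/REDUCTIONS.md §B3t.
-/

namespace Summit.CriticalPhenomena.PercolationContinuityZ3.Theorems.Pcint

open Finset Literature.Probability.Percolation Literature.Probability.LatticeModels

namespace BondK

open NawK (KState toM WF letters letterIdx NT seteqK actK toM_eq_of_seteqK toM_actK spermKL mem_letters
  nodup_letters sum_letters_eq length_of_WF)

variable {d : ℕ}

/-! ### Row checks -/

section Check

variable (τ kc d N pn S T D lamN lamD : ℕ) (syms : List (List (ℕ × Bool))) (t : NT)

/-- The integer chord numerator: `S² T^{2d-1}` for `c = 0` (factor `1`), `(D-pn)^c · D · T^{2d-c}` for `c ≥ 1`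
(factor `q₁^c / (s² t^{c-1})` over the common denominator `S² T^{2d-1}`). [folklore] -/
def CFnum (c : ℕ) : ℕ := if c = 0 then S ^ 2 * T ^ (2 * d - 1) else (D - pn) ^ c * D * T ^ (2 * d - c)

/-- The integer value of one letter of a row. [folklore] -/
def termValT (L : KState) (a : Fin d × Bool) (os : Option (ℕ × ℕ)) : ℕ :=
  match os with
  | none => 0
  | some jc => pn * CFnum d pn S T D (bchordK d L a) * S ^ (cdetK d τ kc L a - ctuK d kc L a) * T ^ ctuK d kc L a *
      D ^ (6 * d - cdetK d τ kc L a) * (if bcornerK d L a then D * D + S * S else 2 * (D * D)) * NawK.vOf t jc.1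

/-- The integer row sum. [folklore] -/
def rowValT (L : KState) (sc : ℕ → Option (ℕ × ℕ)) : ℕ :=
  ((letters d).map fun a => termValT τ kc d pn S T D t L a (sc (letterIdx a))).sum

/-- **The row check** (B3t). [folklore] -/
def checkRowT (i : ℕ) : Bool :=
  match t.find i with
  | none => false
  | some v =>
    WF d v.2.1 && decide (1 ≤ v.1) &&
      (letters d).all (fun a => termOKB τ d N syms t v.2.1 a (v.2.2.getD (letterIdx a) none)) &&
      decide (lamD * rowValT τ kc d pn S T D t v.2.1 (fun k => v.2.2.getD k none) ≤
        lamN * (2 * S ^ 2 * T ^ (2 * d - 1) * D ^ (6 * d + 3)) * v.1)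

end Check

/-! ### Soundness: checked rows bound `p_c^bond(ℤ^d)` from below -/

section Sound

variable {τ kc d N pn S T D lamN lamD : ℕ} {syms : List (List (ℕ × Bool))} {t : NT}

/-- What a passed row check says. [folklore] -/
theorem checkRowT_spec {i : ℕ} (h : checkRowT τ kc d N pn S T D lamN lamD syms t i = true) :
    ∃ v, t.find i = some v ∧ WF d v.2.1 = true ∧ 1 ≤ v.1 ∧
      (∀ a, termOKB τ d N syms t v.2.1 a (v.2.2.getD (letterIdx a) none) = true) ∧
      lamD * rowValT τ kc d pn S T D t v.2.1 (fun k => v.2.2.getD k none) ≤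
        lamN * (2 * S ^ 2 * T ^ (2 * d - 1) * D ^ (6 * d + 3)) * v.1 := by
  unfold checkRowT at h
  cases hf : t.find i with
  | none => rw [hf] at h; exact Bool.noConfusion h
  | some v =>
    rw [hf] at h
    simp only [Bool.and_eq_true, decide_eq_true_eq, List.all_eq_true] at h
    obtain ⟨⟨⟨hwf, hv⟩, hall⟩, hineq⟩ := h
    exact ⟨v, rfl, hwf, hv, fun a => hall a (mem_letters a), hineq⟩

/-- The real value of the chord numerator. [folklore] -/
theorem CFnum_real_eq {c : ℕ} (hc : c ≤ 2 * d) (hS : (0 : ℝ) < S) (hT : (0 : ℝ) < T) (hD : (0 : ℝ) < D) :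
    ((CFnum d pn S T D c : ℕ) : ℝ) / ((S : ℝ) ^ 2 * (T : ℝ) ^ (2 * d - 1)) =
      tchordF (((D - pn : ℕ) : ℝ) / D) ((S : ℝ) / D) ((T : ℝ) / D) c := by
  unfold CFnum tchordF
  split_ifs with h0
  · push_cast; field_simp
  · obtain ⟨m, rfl⟩ : ∃ m, c = m + 1 := ⟨c - 1, by omega⟩
    have e1 : (T : ℝ) ^ (2 * d - 1) = (T : ℝ) ^ (2 * d - (m + 1)) * (T : ℝ) ^ m := by rw [← pow_add]; congr 1; omega
    rw [show m + 1 - 1 = m by omega, e1]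
    simp only [div_pow]
    push_cast
    field_simp
    ring

/-- The real value of an integer letter term. [folklore] -/
theorem termValT_real_eq {CF us ut u F Vj : ℕ} (hut : ut ≤ u) (hu : u ≤ 6 * d) (hus : us = u - ut) (hD : (0 : ℝ) < D)
    (hS : (0 : ℝ) < S) (hT : (0 : ℝ) < T) :
    ((pn * CF * S ^ us * T ^ ut * D ^ (6 * d - u) * F * Vj : ℕ) : ℝ) /
        (2 * (S : ℝ) ^ 2 * (T : ℝ) ^ (2 * d - 1) * (D : ℝ) ^ (6 * d + 3)) =
      (pn : ℝ) / D * (((CF : ℕ) : ℝ) / ((S : ℝ) ^ 2 * (T : ℝ) ^ (2 * d - 1))) *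
        (((S : ℝ) / D) ^ us * ((T : ℝ) / D) ^ ut) * ((F : ℝ) / (2 * (D : ℝ) ^ 2)) * Vj := by
  have hsplit : (D : ℝ) ^ (6 * d + 3) = D * ((D : ℝ) ^ us * (D : ℝ) ^ ut) * (D : ℝ) ^ (6 * d - u) * (D : ℝ) ^ 2 := by
    rw [← pow_add, ← pow_succ', ← pow_add, ← pow_add]; congr 1; omega
  rw [hsplit, div_pow, div_pow]
  push_cast
  field_simp

/-- **Soundness of the kernel certificate (bond, B3t).** [folklore] -/
theorem le_criticalProb_of_checkRowsT [NeZero d] (hτ : kc + 4 ≤ τ) (hkc : 2 ≤ kc) (sym : ℕ → SPerm d)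
    (hsyms : ∀ c < syms.length, syms.getD c [] = spermKL (sym c))
    (hrows : ∀ i < N, checkRowT τ kc d N pn S T D lamN lamD syms t i = true)
    (hN : 0 < N) (h0 : NawK.stOf t 0 = []) (hD : 0 < D) (hpn : pn ≤ D) (hS1 : S ≤ D) (hTS : T ≤ S) (hT0 : 0 < T)
    (hSS : D ^ 2 ≤ S ^ 2 + pn ^ 2) (htp : (D - pn) * (D + 2 * pn) ≤ T * (D + pn))
    (hst : pn ^ 2 * (D - pn) ≤ S ^ 2 * (S - T)) (hqt : (D - pn) * D ^ 2 ≤ S * T ^ 2) (hts2 : T * D ≤ S ^ 2)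
    (hlam : lamN < lamD) :
    (pn : ℝ) / D ≤ criticalProb (zdGraph d) 0 := by
  classical
  have hDr : (0 : ℝ) < D := Nat.cast_pos.2 hD
  have hTr : (0 : ℝ) < T := Nat.cast_pos.2 hT0
  have hS0 : 0 < S := lt_of_lt_of_le hT0 hTS
  have hSr : (0 : ℝ) < S := Nat.cast_pos.2 hS0
  have hlamDr : (0 : ℝ) < lamD := Nat.cast_pos.2 (by omega)
  -- the constants
  set p : unitInterval := ⟨(pn : ℝ) / D, div_nonneg (Nat.cast_nonneg _) hDr.le,
    div_le_one_of_le₀ (by exact_mod_cast hpn) hDr.le⟩ with hp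
  set s : ℝ := (S : ℝ) / D with hs
  set tv : ℝ := (T : ℝ) / D with htv
  set κb : ℝ := ((D : ℝ) * D + (S : ℝ) * S) / (2 * (D : ℝ) ^ 2) with hκb
  set lam : ℝ := (lamN : ℝ) / lamD with hlamdef
  have hpc : (p : ℝ) = (pn : ℝ) / D := rfl
  have hsub : (((D - pn : ℕ) : ℝ)) = (D : ℝ) - pn := Nat.cast_sub hpn
  have hsubT : (((S - T : ℕ) : ℝ)) = (S : ℝ) - T := Nat.cast_sub hTS
  have hq1 : 1 - (p : ℝ) = (((D - pn : ℕ) : ℝ)) / D := by rw [hsub, hpc]; field_simp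
  have hs0' : 0 < s := div_pos hSr hDr
  have hs1' : s ≤ 1 := div_le_one_of_le₀ (by exact_mod_cast hS1) hDr.le
  have ht0' : 0 < tv := div_pos hTr hDr
  have hts' : tv ≤ s := div_le_div_of_nonneg_right (by exact_mod_cast hTS) hDr.le
  have hSr1 : (S : ℝ) ≤ D := by exact_mod_cast hS1
  have hκ : (1 + s ^ 2) / 2 ≤ κb := by rw [hκb, hs]; apply le_of_eq; field_simp
  have hκb1 : κb ≤ 1 := by
    rw [hκb, div_le_one (by positivity)]
    have : (S : ℝ) * S ≤ (D : ℝ) * D := mul_le_mul hSr1 hSr1 (Nat.cast_nonneg _) hDr.le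
    nlinarith [this]
  have hκb0 : 0 ≤ κb := by rw [hκb]; positivity
  have hlam0 : 0 ≤ lam := div_nonneg (Nat.cast_nonneg _) hlamDr.le
  have hlam1 : lam < 1 := (div_lt_one hlamDr).2 (by exact_mod_cast hlam)
  have hps : 1 - (p : ℝ) ^ 2 ≤ s ^ 2 := by
    have key : (D : ℝ) ^ 2 ≤ (S : ℝ) ^ 2 + (pn : ℝ) ^ 2 := by exact_mod_cast hSS
    rw [hpc, hs, div_pow, div_pow, sub_le_iff_le_add, ← add_div, le_div_iff₀ (by positivity), one_mul]
    exact key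
  have htp' : (1 - (p : ℝ)) * (1 + 2 * p) ≤ tv * (1 + p) := by
    have key : ((D : ℝ) - pn) * (D + 2 * pn) ≤ (T : ℝ) * (D + pn) := by rw [← hsub]; exact_mod_cast htp
    rw [hpc, htv]
    rw [show (1 - (pn : ℝ) / D) * (1 + 2 * ((pn : ℝ) / D)) = ((D : ℝ) - pn) * (D + 2 * pn) / ((D : ℝ) * D) by
      field_simp, show (T : ℝ) / D * (1 + (pn : ℝ) / D) = (T : ℝ) * (D + pn) / ((D : ℝ) * D) by field_simp]
    exact div_le_div_of_nonneg_right key (by positivity)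
  have hst' : (p : ℝ) ^ 2 * (1 - p) ≤ s ^ 2 * (s - tv) := by
    have key : (pn : ℝ) ^ 2 * ((D : ℝ) - pn) ≤ (S : ℝ) ^ 2 * ((S : ℝ) - T) := by
      rw [← hsub, ← hsubT]; exact_mod_cast hst
    rw [hpc, hs, htv]
    rw [show ((pn : ℝ) / D) ^ 2 * (1 - (pn : ℝ) / D) = (pn : ℝ) ^ 2 * ((D : ℝ) - pn) / (D : ℝ) ^ 3 by field_simp,
      show ((S : ℝ) / D) ^ 2 * ((S : ℝ) / D - (T : ℝ) / D) = (S : ℝ) ^ 2 * ((S : ℝ) - T) / (D : ℝ) ^ 3 by field_simp]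
    exact div_le_div_of_nonneg_right key (by positivity)
  have hqt' : 1 - (p : ℝ) ≤ s * tv ^ 2 := by
    have key : ((D : ℝ) - pn) * (D : ℝ) ^ 2 ≤ (S : ℝ) * (T : ℝ) ^ 2 := by rw [← hsub]; exact_mod_cast hqt
    rw [hpc, hs, htv]
    rw [show (1 - (pn : ℝ) / D) = ((D : ℝ) - pn) * (D : ℝ) ^ 2 / (D : ℝ) ^ 3 by field_simp,
      show (S : ℝ) / D * ((T : ℝ) / D) ^ 2 = (S : ℝ) * (T : ℝ) ^ 2 / (D : ℝ) ^ 3 by field_simp]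
    exact div_le_div_of_nonneg_right key (by positivity)
  have hts2' : tv ≤ s ^ 2 := by
    have key : (T : ℝ) * D ≤ (S : ℝ) ^ 2 := by exact_mod_cast hts2
    rw [hs, htv, div_pow, div_le_div_iff₀ hDr (by positivity)]
    nlinarith [key]
  have hq0 : 0 ≤ 1 - (p : ℝ) := sub_nonneg.2 p.2.2
  have hq_t : 1 - (p : ℝ) ≤ tv := hqt'.trans (by
    have ht1 : tv ≤ 1 := hts'.trans hs1'
    nlinarith [mul_le_mul ht1 ht1 ht0'.le zero_le_one])
  have hq_s2 : 1 - (p : ℝ) ≤ s ^ 2 := hq_t.trans hts2'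
  -- the semantic table
  let Rw : Fin N → MState d := fun i => toM (NawK.stOf t i)
  let V : Fin N → ℝ := fun i => (NawK.vOf t i : ℝ)
  let sc : Fin N → Fin d × Bool → Option (Fin N × SPerm d) := fun i a =>
    match NawK.scOf t i (letterIdx a) with
    | none => none
    | some jc => if h : jc.1 < N then some ((⟨jc.1, h⟩ : Fin N), sym jc.2) else none
  have hrow : ∀ i : Fin N, ∃ v, t.find i = some v ∧ WF d v.2.1 = true ∧ 1 ≤ v.1 ∧
      (∀ a, termOKB τ d N syms t v.2.1 a (v.2.2.getD (letterIdx a) none) = true) ∧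
      lamD * rowValT τ kc d pn S T D t v.2.1 (fun k => v.2.2.getD k none) ≤
        lamN * (2 * S ^ 2 * T ^ (2 * d - 1) * D ^ (6 * d + 3)) * v.1 :=
    fun i => checkRowT_spec (hrows i i.2)
  have hst : ∀ (i : Fin N) v, t.find i = some v → NawK.stOf t i = v.2.1 := fun i v h => by simp [NawK.stOf, h]
  have hv : ∀ (i : Fin N) v, t.find i = some v → NawK.vOf t i = v.1 := fun i v h => by simp [NawK.vOf, h]
  have hsc : ∀ (i : Fin N) v, t.find i = some v → ∀ k, NawK.scOf t i k = v.2.2.getD k none := fun i v h k => by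
    simp [NawK.scOf, h]
  have hV : ∀ i, 1 ≤ V i := fun i => by
    obtain ⟨v, hf, -, hv1, -⟩ := hrow i
    show (1 : ℝ) ≤ (NawK.vOf t i : ℝ)
    rw [hv i v hf]; exact_mod_cast hv1
  have h0' : Rw ⟨0, hN⟩ = ∅ := by
    show toM (NawK.stOf t 0) = (∅ : MState d)
    rw [h0]; rfl
  -- simulation
  have hsim : ∀ i a, simRel Rw (mstep τ (Rw i) a) (sc i a) = true := by
    intro i a
    obtain ⟨v, hf, hwf, -, hok, -⟩ := hrow i
    have hRi : Rw i = toM v.2.1 := by show toM (NawK.stOf t i) = _; rw [hst i v hf]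
    have hoka := hok a
    unfold termOKB at hoka
    have hsci : sc i a = (match v.2.2.getD (letterIdx a) none with
        | none => none
        | some jc => if h : jc.1 < N then some ((⟨jc.1, h⟩ : Fin N), sym jc.2) else none) := by
      show (match NawK.scOf t i (letterIdx a) with
        | none => none
        | some jc => if h : jc.1 < N then some ((⟨jc.1, h⟩ : Fin N), sym jc.2) else none) = _
      rw [hsc i v hf]
    rw [hRi, mstep_toM hwf, hsci]
    cases hT : mstepK τ d v.2.1 a with
    | none =>
      rw [hT] at hoka
      cases hos : v.2.2.getD (letterIdx a) none with
      | none => rfl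
      | some jc => rw [hos] at hoka; exact Bool.noConfusion hoka
    | some T' =>
      rw [hT] at hoka
      cases hos : v.2.2.getD (letterIdx a) none with
      | none => rw [hos] at hoka; exact Bool.noConfusion hoka
      | some jc =>
        rw [hos] at hoka
        rcases jc with ⟨j, c⟩
        simp only [Bool.and_eq_true, decide_eq_true_eq] at hoka
        obtain ⟨⟨hjN, hc⟩, hseq⟩ := hoka
        simp only [Option.map_some, dif_pos hjN, simRel, decide_eq_true_eq]
        rw [toM_eq_of_seteqK hseq, hsyms c hc, toM_actK]
  -- Collatz–Wielandt rows
  set DEN : ℝ := 2 * (S : ℝ) ^ 2 * (T : ℝ) ^ (2 * d - 1) * (D : ℝ) ^ (6 * d + 3) with hDEN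
  have hDEN0 : 0 < DEN := by positivity
  have hcw : ∀ i, (∑ a : Fin d × Bool, match sc i a with
      | none => 0
      | some jg => (p : ℝ) * btwt (1 - p) s tv κb τ kc (Rw i) a * V jg.1) ≤ lam * V i := by
    intro i
    obtain ⟨v, hf, hwf, hv1, hok, hineq⟩ := hrow i
    have hRi : Rw i = toM v.2.1 := by show toM (NawK.stOf t i) = _; rw [hst i v hf]
    have hterm : ∀ a, (match sc i a with
        | none => 0
        | some jg => (p : ℝ) * btwt (1 - p) s tv κb τ kc (Rw i) a * V jg.1) ≤
        (termValT τ kc d pn S T D t v.2.1 a (v.2.2.getD (letterIdx a) none) : ℝ) / DEN := by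
      intro a
      have hoka := hok a
      unfold termOKB at hoka
      have hsci : sc i a = (match v.2.2.getD (letterIdx a) none with
          | none => none
          | some jc => if h : jc.1 < N then some ((⟨jc.1, h⟩ : Fin N), sym jc.2) else none) := by
        show (match NawK.scOf t i (letterIdx a) with
          | none => none
          | some jc => if h : jc.1 < N then some ((⟨jc.1, h⟩ : Fin N), sym jc.2) else none) = _
        rw [hsc i v hf]
      rw [hsci]
      cases hos : v.2.2.getD (letterIdx a) none with
      | none => simp only [termValT, Nat.cast_zero, zero_div, le_refl]
      | some jc =>
        rw [hos] at hoka
        cases hT : mstepK τ d v.2.1 a with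
        | none => rw [hT] at hoka; exact Bool.noConfusion hoka
        | some T' =>
          rw [hT] at hoka
          rcases jc with ⟨j, c⟩
          simp only [Bool.and_eq_true, decide_eq_true_eq] at hoka
          obtain ⟨⟨hjN, -⟩, -⟩ := hoka
          simp only [dif_pos hjN, termValT]
          set L := v.2.1 with hL
          have hcK := bchordK_le L a (d := d)
          have huK := cdetK_le τ kc L a (d := d)
          have hutK := ctuK_le_cdetK τ kc L a (d := d)
          rw [hDEN, termValT_real_eq hutK (by omega) rfl hDr hSr hTr, CFnum_real_eq hcK hSr hTr hDr, ← hq1]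
          have hVj : V ⟨j, hjN⟩ = (NawK.vOf t j : ℝ) := rfl
          rw [hVj, hRi]
          -- compare factor by factor
          have hc := bchordK_le_bchord hwf a (d := d)
          have hu := cdetK_le_cdet hwf a (d := d) (τ := τ) (kc := kc)
          have hut := ctuK_le_ctu hwf a (d := d) (kc := kc)
          have hctu := ctu_le_cdet τ kc (toM L : MState d) a
          have hchord : tchordF (1 - (p : ℝ)) s tv (bchord (toM L : MState d) a) ≤
              tchordF (1 - (p : ℝ)) s tv (bchordK d L a) := tchordF_anti hq0 hq_t hq_s2 hs0' ht0' hc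
          have hunits : s ^ (cdet τ kc (toM L : MState d) a - ctu kc (toM L : MState d) a) * tv ^ ctu kc (toM L : MState d) a ≤
              s ^ (cdetK d τ kc L a - ctuK d kc L a) * tv ^ ctuK d kc L a :=
            ChainBond.spow_tpow_le hs1' ht0'.le hts' hut (by omega)
          have hcf : (if bcorner (toM L : MState d) a then κb else 1) ≤
              (((if bcornerK d L a then D * D + S * S else 2 * (D * D) : ℕ) : ℝ) / (2 * (D : ℝ) ^ 2)) := by
            by_cases hcK : bcornerK d L a = true
            · rw [if_pos (bcorner_of_bcornerK hwf a hcK), if_pos hcK, hκb]; push_cast; exact le_of_eq (by ring)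
            · rw [if_neg hcK]
              have e2 : (((2 * (D * D) : ℕ) : ℝ)) / (2 * (D : ℝ) ^ 2) = 1 := by push_cast; field_simp
              rw [e2]
              split_ifs
              · exact hκb1
              · exact le_rfl
          have hp0 : (0 : ℝ) ≤ (pn : ℝ) / D := div_nonneg (Nat.cast_nonneg _) hDr.le
          have hchord0 : 0 ≤ tchordF (1 - (p : ℝ)) s tv (bchord (toM L : MState d) a) := tchordF_nonneg hq0 hs0'.le ht0'.le _
          have hchordK0 : 0 ≤ tchordF (1 - (p : ℝ)) s tv (bchordK d L a) := tchordF_nonneg hq0 hs0'.le ht0'.le _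
          have hunits0 : 0 ≤ s ^ (cdet τ kc (toM L : MState d) a - ctu kc (toM L : MState d) a) * tv ^ ctu kc (toM L : MState d) a := by
            positivity
          have hcor0 : (0 : ℝ) ≤ (if bcorner (toM L : MState d) a then κb else 1) := by split_ifs; exact hκb0; exact zero_le_one
          have hF0 : (0 : ℝ) ≤ (((if bcornerK d L a then D * D + S * S else 2 * (D * D) : ℕ) : ℝ) / (2 * (D : ℝ) ^ 2)) := by
            positivity
          show (pn : ℝ) / D * (tchordF (1 - (p : ℝ)) s tv (bchord (toM L : MState d) a) *
              (s ^ (cdet τ kc (toM L : MState d) a - ctu kc (toM L : MState d) a) * tv ^ ctu kc (toM L : MState d) a *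
                (if bcorner (toM L : MState d) a then κb else 1))) * (NawK.vOf t j : ℝ) ≤ _
          calc (pn : ℝ) / D * (tchordF (1 - (p : ℝ)) s tv (bchord (toM L : MState d) a) *
                (s ^ (cdet τ kc (toM L : MState d) a - ctu kc (toM L : MState d) a) * tv ^ ctu kc (toM L : MState d) a *
                  (if bcorner (toM L : MState d) a then κb else 1))) * (NawK.vOf t j : ℝ)
              ≤ (pn : ℝ) / D * (tchordF (1 - (p : ℝ)) s tv (bchordK d L a) *
                  (s ^ (cdetK d τ kc L a - ctuK d kc L a) * tv ^ ctuK d kc L a *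
                    ((((if bcornerK d L a then D * D + S * S else 2 * (D * D) : ℕ) : ℝ) / (2 * (D : ℝ) ^ 2))))) *
                  (NawK.vOf t j : ℝ) := by
                refine mul_le_mul_of_nonneg_right (mul_le_mul_of_nonneg_left (mul_le_mul hchord
                  (mul_le_mul hunits hcf hcor0 (by positivity)) (mul_nonneg hunits0 hcor0) hchordK0) hp0) (Nat.cast_nonneg _)
            _ = _ := by ring
    calc (∑ a : Fin d × Bool, match sc i a with
            | none => 0
            | some jg => (p : ℝ) * btwt (1 - p) s tv κb τ kc (Rw i) a * V jg.1)
        ≤ ∑ a : Fin d × Bool, (termValT τ kc d pn S T D t v.2.1 a (v.2.2.getD (letterIdx a) none) : ℝ) / DEN :=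
          Finset.sum_le_sum fun a _ => hterm a
      _ = (rowValT τ kc d pn S T D t v.2.1 (fun k => v.2.2.getD k none) : ℝ) / DEN := by
          rw [← Finset.sum_div, rowValT, ← sum_letters_eq, Nat.cast_list_sum, List.map_map]; rfl
      _ ≤ lam * V i := by
          rw [div_le_iff₀ hDEN0, hlamdef]
          show _ ≤ (lamN : ℝ) / lamD * (NawK.vOf t i : ℝ) * DEN
          rw [hv i v hf, div_mul_eq_mul_div, div_mul_eq_mul_div, le_div_iff₀ hlamDr]
          calc (rowValT τ kc d pn S T D t v.2.1 (fun k => v.2.2.getD k none) : ℝ) * lamD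
              = ((lamD * rowValT τ kc d pn S T D t v.2.1 (fun k => v.2.2.getD k none) : ℕ) : ℝ) := by push_cast; ring
            _ ≤ ((lamN * (2 * S ^ 2 * T ^ (2 * d - 1) * D ^ (6 * d + 3)) * v.1 : ℕ) : ℝ) := by exact_mod_cast hineq
            _ = (lamN : ℝ) * (v.1 : ℝ) * DEN := by rw [hDEN]; push_cast; ring
  have main := le_criticalProb_zd_of_thirdMemTable (d := d) hτ hkc p hps hs0' hs1' ht0' hts' htp' hst' hqt' hts2' hκ hlam0 hlam1
    Rw sc V ⟨0, hN⟩ h0' hV hsim hcw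
  exact main

end Sound

end BondK

end Summit.CriticalPhenomena.PercolationContinuityZ3.Theorems.Pcint
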